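import Summits.AtomisticToContinuum.HydrodynamicLimit.Theorems.InformationPercolationEngineChaosClosesEulerStressIsotropyA
import HarnessLib

/-!
# Window-to-cone step of `ParityBandClosure` — helper B: cone fields of one configuration

Support file for the stub `stub_stressIsotropyOfWindowCovariance` of the line `transfer-weighted-parity-chain`
(skeleton v4) of the crux `JParityClosure.ParityBandClosure` (stmt-AtomisticToContinuum-17608).

WHAT.  Deterministic facts about the `r`-cone fields `ρ_r = rhoC`, `m_r = momC`, `e_r = kinC` and the cone
moments `MpsiC` of ONE configuration `w` of `N + 1` particles on `𝕋³`:

* §1 the velocity truncation at speed `V`: `exists_slow_centre` — there is a vector `c` with `‖c‖ ≤ V`,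
  `‖m_r − ρ_r c‖ ≤ T/V` and `‖m_r − ρ_r c‖² ≤ ρ_r T`, `T = MpsiC (sqTail V) = ∫ b_r ‖v‖² 1{V < ‖v‖}` the cone
  quadratic tail (proof: zero the slow velocities and apply the admissibility `‖m‖² ≤ 2ρe` of the tree to the
  fast configuration); whence `norm_sq_sub_div_le` — for EVERY centre `c` with `‖c‖ ≤ V`,
  `‖m_r − ρ_r c‖²/ρ_r ≤ 4V ‖m_r − ρ_r c‖ + 6T` (the linearisation of the bulk-velocity fluctuation used by the
  window-to-cone step: quadratic in the increments only through the tail);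
* §2 the `L¹(dx₀)` displacement of the cone kernel: `∫ |b_r(y, ·) − b_r(y', ·)| ≤ 8 d(y, y')/r`
  (`integral_abs_cone_sub_cone_le`; the kernel is `3/(πr⁴)`-Lipschitz and supported on two balls of volume
  `(4/3)πr³`), hence the `L¹(dx₀)` moduli of `ρ_r`, `m_r` under FREE FLIGHT (`≤ (8h/r)(N+1)⁻¹Σ‖vᵢ‖`,
  `≤ (8h/r)(N+1)⁻¹Σ‖vᵢ‖²`) and under a BINARY MOMENTUM EXCHANGE at distance `d(xᵢ, xⱼ)`
  (`≤ (N+1)⁻¹ (8 d(xᵢ,xⱼ)/r) ‖Δvᵢ‖`; the density does not jump).  Integrating over the field point is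
  what makes the transport term local without any locality bookkeeping.

REFERENCES.  Elementary; the cone fields are those of `Theorems/LocalSecondLaw/Negative/Functional.lean`, the
tails those of `InformationPercolationEngineChaosClosesEulerStressIsotropyA.lean`.
-/

noncomputable section

namespace Summit.AtomisticToContinuum.HydrodynamicLimit.Theorems.ParityBandClosureWindowToCone

open scoped BigOperators Topology Classical MeasureTheory ENNReal InnerProductSpace
open Filter Set MeasureTheory Function
open Literature.MathematicalPhysics.KineticTheory
open Literature.Analysis.FluidPDE
open Literature.Analysis.FunctionSpaces
open Summit.AtomisticToContinuum.HydrodynamicLimit.Theorems.LocalSecondLawNegative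
open Summit.AtomisticToContinuum.HydrodynamicLimit.Theorems.LocalSecondLawLedger
open Summit.AtomisticToContinuum.HydrodynamicLimit.Theorems.LocalSecondLawLedger.L
  (Mmom rhoC_eq_sum momC_apply_eq_sum momC_eq_sum norm_sq_eq_sum)
open Summit.AtomisticToContinuum.HydrodynamicLimit.Theorems.ChaosClosesEulerReduction
open Summit.AtomisticToContinuum.HydrodynamicLimit.Theorems.ChaosClosesEulerStressIsotropy

variable {N : ℕ}

/-! ## §1 Velocity truncation at speed `V` -/

/-- The fast part of a velocity: `‖v 1{V < ‖v‖}‖ ≤ ‖v‖² 1{V < ‖v‖} / V` (`V > 0`). [folklore] -/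
theorem norm_fast_le {V : ℝ} (hV : 0 < V) (v : V3) :
    ‖(if V < ‖v‖ then v else 0)‖ ≤ sqTail V v / V := by
  unfold sqTail
  by_cases h : V < ‖v‖
  · rw [if_pos h, Set.indicator_of_mem (show v ∈ {v : V3 | V < ‖v‖} from h), le_div_iff₀ hV, sq]
    exact mul_le_mul_of_nonneg_left h.le (norm_nonneg _)
  · rw [if_neg h, Set.indicator_of_notMem (show v ∉ {v : V3 | V < ‖v‖} from h), norm_zero, zero_div]

/-- The fast part of a velocity has squared norm `‖v‖² 1{V < ‖v‖}`. [folklore] -/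
theorem norm_fast_sq (V : ℝ) (v : V3) : ‖(if V < ‖v‖ then v else 0)‖ ^ 2 = sqTail V v := by
  unfold sqTail
  by_cases h : V < ‖v‖
  · rw [if_pos h, Set.indicator_of_mem (show v ∈ {v : V3 | V < ‖v‖} from h)]
  · rw [if_neg h, Set.indicator_of_notMem (show v ∉ {v : V3 | V < ‖v‖} from h), norm_zero]; ring

/-- The slow part of a velocity has norm at most `V` (`V ≥ 0`). [folklore] -/
theorem norm_sub_fast_le {V : ℝ} (hV : 0 ≤ V) (v : V3) : ‖v - (if V < ‖v‖ then v else 0)‖ ≤ V := by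
  by_cases h : V < ‖v‖
  · rw [if_pos h, sub_self, norm_zero]; exact hV
  · rw [if_neg h, sub_zero]; exact not_lt.1 h

/-- **The slow centre of a cone.**  For `V > 0` there is `c` with `‖c‖ ≤ V` such that `m_r − ρ_r c` is the cone
momentum of the FAST particles: `‖m_r − ρ_r c‖ ≤ T/V` and `‖m_r − ρ_r c‖² ≤ ρ_r T`, `T = MpsiC (sqTail V)`.
[folklore] -/
theorem exists_slow_centre {r : ℝ} (hr : 0 < r) (w : Phase N) (x : T3) {V : ℝ} (hV : 0 < V) :
    ∃ c : V3, ‖c‖ ≤ V ∧ ‖momC r w x - rhoC r w x • c‖ ≤ MpsiC r w x (sqTail V) / V ∧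
      ‖momC r w x - rhoC r w x • c‖ ^ 2 ≤ rhoC r w x * MpsiC r w x (sqTail V) := by
  -- the fast configuration: slow velocities set to zero
  set w' : Phase N := fun i => ((w i).1, if V < ‖(w i).2‖ then (w i).2 else 0) with hw'
  have hρ' : rhoC r w' x = rhoC r w x := by rw [rhoC_eq_sum, rhoC_eq_sum]
  have hT : MpsiC r w x (sqTail V) = 2 * kinC r w' x := by
    rw [kinC_eq_sum, MpsiC_eq_sum, mul_left_comm, Finset.mul_sum Finset.univ _ (2 : ℝ)]
    refine congrArg (fun s => ((N + 1 : ℕ) : ℝ)⁻¹ * s) (Finset.sum_congr rfl fun i _ => ?_)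
    simp only [hw', norm_fast_sq]
    ring
  have hT0 : 0 ≤ MpsiC r w x (sqTail V) := MpsiC_nonneg hr w x fun v => sqTail_nonneg V v
  have hNn : (0 : ℝ) ≤ ((N + 1 : ℕ) : ℝ)⁻¹ := by positivity
  have hfast : ‖momC r w' x‖ ≤ MpsiC r w x (sqTail V) / V := by
    rw [momC_eq_sum, MpsiC_eq_sum, norm_smul, Real.norm_eq_abs, abs_of_nonneg hNn, mul_div_assoc, Finset.sum_div]
    refine mul_le_mul_of_nonneg_left ((norm_sum_le _ _).trans (Finset.sum_le_sum fun i _ => ?_)) hNn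
    rw [norm_smul, Real.norm_eq_abs, abs_of_nonneg (cone_nonneg hr _ _), mul_div_assoc]
    have h1 := mul_le_mul_of_nonneg_left (norm_fast_le hV (w i).2) (cone_nonneg hr (w i).1 x)
    simpa only [hw'] using h1
  have hfast2 : ‖momC r w' x‖ ^ 2 ≤ rhoC r w x * MpsiC r w x (sqTail V) := by
    have h := norm_momC_sq_le hr w' x
    have e : 2 * rhoC r w' x * kinC r w' x = rhoC r w x * MpsiC r w x (sqTail V) := by rw [hρ', hT]; ring
    rwa [e] at h
  have hslow : ‖momC r w x - momC r w' x‖ ≤ V * rhoC r w x := by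
    have e : momC r w x - momC r w' x = ((N + 1 : ℕ) : ℝ)⁻¹ • ∑ i, cone r (w i).1 x • ((w i).2 - (w' i).2) := by
      rw [momC_eq_sum, momC_eq_sum, ← smul_sub, ← Finset.sum_sub_distrib]
      congr 1
      refine Finset.sum_congr rfl fun i _ => ?_
      simp only [hw', smul_sub]
    rw [e, norm_smul, Real.norm_eq_abs, abs_of_nonneg hNn, rhoC_eq_sum, mul_left_comm, Finset.mul_sum]
    refine mul_le_mul_of_nonneg_left ((norm_sum_le _ _).trans (Finset.sum_le_sum fun i _ => ?_)) hNn
    rw [norm_smul, Real.norm_eq_abs, abs_of_nonneg (cone_nonneg hr _ _), mul_comm]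
    have h1 := mul_le_mul_of_nonneg_right (norm_sub_fast_le hV.le (w i).2) (cone_nonneg hr (w i).1 x)
    simpa only [hw'] using h1
  by_cases hρ : rhoC r w x = 0
  · refine ⟨0, by rw [norm_zero]; exact hV.le, ?_, ?_⟩
    · rw [momC_eq_zero_of_rhoC hr hρ, hρ, zero_smul, sub_zero, norm_zero]; positivity
    · rw [momC_eq_zero_of_rhoC hr hρ, hρ, zero_smul, sub_zero, norm_zero, zero_mul]; norm_num
  · have hρpos : 0 < rhoC r w x := lt_of_le_of_ne (rhoC_nonneg hr w x) (Ne.symm hρ)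
    refine ⟨(rhoC r w x)⁻¹ • (momC r w x - momC r w' x), ?_, ?_, ?_⟩
    · rw [norm_smul, Real.norm_eq_abs, abs_of_pos (inv_pos.2 hρpos), inv_mul_le_iff₀ hρpos, mul_comm]
      exact hslow
    · rw [smul_smul, mul_inv_cancel₀ hρ, one_smul, sub_sub_cancel]
      exact hfast
    · rw [smul_smul, mul_inv_cancel₀ hρ, one_smul, sub_sub_cancel]
      exact hfast2

/-- **Linearised bulk-velocity fluctuation.**  For every centre `c` with `‖c‖ ≤ V` (`V > 0`):
`‖m_r − ρ_r c‖² / ρ_r ≤ 4V ‖m_r − ρ_r c‖ + 6 MpsiC (sqTail V)` (junk branch `ρ_r = 0` included). [folklore] -/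
theorem norm_sq_sub_div_le {r : ℝ} (hr : 0 < r) (w : Phase N) (x : T3) {V : ℝ} (hV : 0 < V) {c : V3}
    (hc : ‖c‖ ≤ V) :
    ‖momC r w x - rhoC r w x • c‖ ^ 2 / rhoC r w x ≤
      4 * V * ‖momC r w x - rhoC r w x • c‖ + 6 * MpsiC r w x (sqTail V) := by
  have hT0 : 0 ≤ MpsiC r w x (sqTail V) := MpsiC_nonneg hr w x fun v => sqTail_nonneg V v
  by_cases hρ : rhoC r w x = 0
  · rw [hρ, div_zero]; positivity
  have hρpos : 0 < rhoC r w x := lt_of_le_of_ne (rhoC_nonneg hr w x) (Ne.symm hρ)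
  obtain ⟨c', hc', h1, h2⟩ := exists_slow_centre hr w x hV
  set m := momC r w x
  set ρ := rhoC r w x
  set T := MpsiC r w x (sqTail V)
  -- the slow piece `ρ (c' − c)`
  have hs1 : ‖ρ • c' - ρ • c‖ ≤ 2 * V * ρ := by
    rw [← smul_sub, norm_smul, Real.norm_eq_abs, abs_of_pos hρpos]
    calc ρ * ‖c' - c‖ ≤ ρ * (V + V) :=
          mul_le_mul_of_nonneg_left ((norm_sub_le _ _).trans (add_le_add hc' hc)) hρpos.le
      _ = 2 * V * ρ := by ring
  have hs2 : ‖ρ • c' - ρ • c‖ ≤ ‖m - ρ • c‖ + T / V := by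
    calc ‖ρ • c' - ρ • c‖ = ‖(m - ρ • c) - (m - ρ • c')‖ := by congr 1; abel
      _ ≤ ‖m - ρ • c‖ + ‖m - ρ • c'‖ := norm_sub_le _ _
      _ ≤ ‖m - ρ • c‖ + T / V := by linarith [h1]
  have hsq : ‖m - ρ • c‖ ^ 2 ≤ 2 * ‖ρ • c' - ρ • c‖ ^ 2 + 2 * ‖m - ρ • c'‖ ^ 2 := by
    have e : m - ρ • c = (ρ • c' - ρ • c) + (m - ρ • c') := by abel
    have h3 : ‖m - ρ • c‖ ≤ ‖ρ • c' - ρ • c‖ + ‖m - ρ • c'‖ := by rw [e]; exact norm_add_le _ _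
    have h4 := pow_le_pow_left₀ (norm_nonneg _) h3 2
    nlinarith [h4, sq_nonneg (‖ρ • c' - ρ • c‖ - ‖m - ρ • c'‖)]
  have hA : ‖ρ • c' - ρ • c‖ ^ 2 ≤ 2 * V * ρ * ‖m - ρ • c‖ + 2 * ρ * T := by
    have h5 : ‖ρ • c' - ρ • c‖ ^ 2 ≤ 2 * V * ρ * (‖m - ρ • c‖ + T / V) := by
      rw [sq]
      exact mul_le_mul hs1 hs2 (norm_nonneg _) (by positivity)
    have hB : 2 * V * ρ * (‖m - ρ • c‖ + T / V) = 2 * V * ρ * ‖m - ρ • c‖ + 2 * ρ * T := by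
      have hVne : V ≠ 0 := hV.ne'
      field_simp
    rwa [hB] at h5
  rw [div_le_iff₀ hρpos]
  calc ‖m - ρ • c‖ ^ 2 ≤ 2 * (2 * V * ρ * ‖m - ρ • c‖ + 2 * ρ * T) + 2 * (ρ * T) := by linarith [hsq, hA, h2]
    _ = (4 * V * ‖m - ρ • c‖ + 6 * T) * ρ := by ring

/-! ## §2 The `L¹(dx₀)` displacement of the cone kernel -/

/-- The Haar volume of a minimal-image ball of radius `r < 1/2` in `𝕋³`, as a real number. [folklore] -/
theorem volume_real_ball {r : ℝ} (hr : 0 < r) (hr2 : r < 1 / 2) (y : T3) :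
    (volume ({x | Torus.euclidDist x y < r} : Set T3)).toReal = 4 / 3 * Real.pi * r ^ 3 := by
  rw [Torus.volume_euclidDist_lt hr2 y, EuclideanSpace.volume_ball_fin_three, ENNReal.toReal_mul,
    ← ENNReal.ofReal_pow hr.le, ENNReal.toReal_ofReal (by positivity), ENNReal.toReal_ofReal (by positivity)]
  ring

/-- Pointwise: `|b_r(y, x) − b_r(y', x)| ≤ (3/(πr⁴)) d(y,y') (1_{B_r(y)}(x) + 1_{B_r(y')}(x))`. [folklore] -/
theorem abs_cone_sub_cone_le_indicator {r : ℝ} (hr : 0 < r) (y y' x : T3) :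
    |cone r y x - cone r y' x| ≤ 3 / (Real.pi * r ^ 4) * Torus.euclidDist y y' *
      (({x | Torus.euclidDist x y < r} : Set T3).indicator (fun _ => (1 : ℝ)) x +
        ({x | Torus.euclidDist x y' < r} : Set T3).indicator (fun _ => (1 : ℝ)) x) := by
  have hL : |cone r y x - cone r y' x| ≤ 3 / (Real.pi * r ^ 4) * Torus.euclidDist y y' :=
    gridUp_abs_cone_sub_cone_le hr y y' x
  have hC : 0 ≤ 3 / (Real.pi * r ^ 4) * Torus.euclidDist y y' :=
    mul_nonneg (by positivity) (norm_nonneg _)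
  by_cases hy : Torus.euclidDist x y < r
  · rw [Set.indicator_of_mem (show x ∈ {x | Torus.euclidDist x y < r} from hy)]
    have h1 : (0 : ℝ) ≤ ({x | Torus.euclidDist x y' < r} : Set T3).indicator (fun _ => (1 : ℝ)) x :=
      Set.indicator_nonneg (fun _ _ => zero_le_one) _
    nlinarith
  by_cases hy' : Torus.euclidDist x y' < r
  · rw [Set.indicator_of_mem (show x ∈ {x | Torus.euclidDist x y' < r} from hy')]
    have h1 : (0 : ℝ) ≤ ({x | Torus.euclidDist x y < r} : Set T3).indicator (fun _ => (1 : ℝ)) x :=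
      Set.indicator_nonneg (fun _ _ => zero_le_one) _
    nlinarith
  · have h0 : cone r y x = 0 :=
      DensityCapNegative.cone_eq_zero_of_le hr (by rw [Torus.euclidDist_comm]; exact not_lt.1 hy)
    have h0' : cone r y' x = 0 :=
      DensityCapNegative.cone_eq_zero_of_le hr (by rw [Torus.euclidDist_comm]; exact not_lt.1 hy')
    rw [h0, h0', sub_zero, abs_zero]
    exact mul_nonneg hC (add_nonneg (Set.indicator_nonneg (fun _ _ => zero_le_one) _)
      (Set.indicator_nonneg (fun _ _ => zero_le_one) _))

/-- **`L¹(dx₀)` displacement of the cone kernel**: `∫ |b_r(y, x) − b_r(y', x)| dx ≤ 8 d(y, y') / r` for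
`0 < r < 1/2`. [folklore] -/
theorem integral_abs_cone_sub_cone_le {r : ℝ} (hr : 0 < r) (hr2 : r < 1 / 2) (y y' : T3) :
    ∫ x, |cone r y x - cone r y' x| ≤ 8 * Torus.euclidDist y y' / r := by
  have hmeas : ∀ z : T3, MeasurableSet ({x | Torus.euclidDist x z < r} : Set T3) := fun z =>
    (isOpen_ball_euclidDist z r).measurableSet
  have hint : ∀ z : T3, Integrable (({x | Torus.euclidDist x z < r} : Set T3).indicator (fun _ => (1 : ℝ))) volume :=
    fun z => (integrable_const (1 : ℝ)).indicator (hmeas z)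
  have hd : 0 ≤ Torus.euclidDist y y' := norm_nonneg _
  calc ∫ x, |cone r y x - cone r y' x|
      ≤ ∫ x, 3 / (Real.pi * r ^ 4) * Torus.euclidDist y y' *
          (({x | Torus.euclidDist x y < r} : Set T3).indicator (fun _ => (1 : ℝ)) x +
            ({x | Torus.euclidDist x y' < r} : Set T3).indicator (fun _ => (1 : ℝ)) x) := by
        refine integral_mono ?_ (((hint y).add (hint y')).const_mul _) fun x => abs_cone_sub_cone_le_indicator hr y y' x
        exact (integrable_of_continuous_T3 ((continuous_cone r y).sub (continuous_cone r y'))).abs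
    _ = 3 / (Real.pi * r ^ 4) * Torus.euclidDist y y' * (4 / 3 * Real.pi * r ^ 3 + 4 / 3 * Real.pi * r ^ 3) := by
        rw [integral_const_mul, integral_add (hint y) (hint y'), integral_indicator_const _ (hmeas y),
          integral_indicator_const _ (hmeas y')]
        simp only [smul_eq_mul, mul_one, measureReal_def, volume_real_ball hr hr2]
    _ = 8 * Torus.euclidDist y y' / r := by
        field_simp
        ring

/-! ## §3 `L¹(dx₀)` moduli of the cone fields under free flight -/

/-- A freely moving particle displaces by at most `h ‖v‖` in minimal-image distance (`h ≥ 0`). [folklore] -/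
theorem euclidDist_freeFlight_le {h : ℝ} (hh : 0 ≤ h) (w : Phase N) (i : Fin (N + 1)) :
    Torus.euclidDist (freeFlight (Torus.geometry (Fin 3)) h w i).1 (w i).1 ≤ h * ‖(w i).2‖ := by
  change Torus.euclidDist ((w i).1 + Torus.proj (h • (w i).2)) (w i).1 ≤ h * ‖(w i).2‖
  have h1 := Torus.euclidDist_translate_le (w i).1 (w i).1 (h • (w i).2) 0
  rw [Torus.proj_zero, add_zero, Torus.euclidDist_self, zero_add, sub_zero, norm_smul, Real.norm_eq_abs,
    abs_of_nonneg hh] at h1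
  exact h1

/-- **`L¹(dx₀)` modulus of the mollified density under free flight**:
`∫ |ρ_r(S_h w) − ρ_r(w)| dx₀ ≤ (8h/r) (N+1)⁻¹ Σᵢ ‖vᵢ‖`. [folklore] -/
theorem integral_abs_rhoC_freeFlight_sub_le {r : ℝ} (hr : 0 < r) (hr2 : r < 1 / 2) {h : ℝ} (hh : 0 ≤ h)
    (w : Phase N) :
    ∫ x, |rhoC r (freeFlight (Torus.geometry (Fin 3)) h w) x - rhoC r w x| ≤
      8 * h / r * (((N + 1 : ℕ) : ℝ)⁻¹ * ∑ i, ‖(w i).2‖) := by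
  set w' := freeFlight (Torus.geometry (Fin 3)) h w with hw'
  have hpt : ∀ x, |rhoC r w' x - rhoC r w x| ≤ ((N + 1 : ℕ) : ℝ)⁻¹ * ∑ i, |cone r (w' i).1 x - cone r (w i).1 x| := by
    intro x
    rw [rhoC_eq_sum, rhoC_eq_sum, ← mul_sub, ← Finset.sum_sub_distrib, abs_mul, abs_of_nonneg (by positivity)]
    exact mul_le_mul_of_nonneg_left (Finset.abs_sum_le_sum_abs _ _) (by positivity)
  have hci : ∀ i : Fin (N + 1), Integrable (fun x => |cone r (w' i).1 x - cone r (w i).1 x|) volume := fun i =>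
    (integrable_of_continuous_T3 ((continuous_cone r _).sub (continuous_cone r _))).abs
  calc ∫ x, |rhoC r w' x - rhoC r w x| ≤ ∫ x, ((N + 1 : ℕ) : ℝ)⁻¹ * ∑ i, |cone r (w' i).1 x - cone r (w i).1 x| :=
        integral_mono_of_nonneg (ae_of_all _ fun x => abs_nonneg _) ((integrable_finsetSum _ fun i _ => hci i).const_mul _)
          (ae_of_all _ hpt)
    _ = ((N + 1 : ℕ) : ℝ)⁻¹ * ∑ i, ∫ x, |cone r (w' i).1 x - cone r (w i).1 x| := by
        rw [integral_const_mul, integral_finsetSum _ fun i _ => hci i]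
    _ ≤ ((N + 1 : ℕ) : ℝ)⁻¹ * ∑ i, 8 * (h * ‖(w i).2‖) / r := by
        refine mul_le_mul_of_nonneg_left (Finset.sum_le_sum fun i _ => ?_) (by positivity)
        refine (integral_abs_cone_sub_cone_le hr hr2 _ _).trans ?_
        exact div_le_div_of_nonneg_right (mul_le_mul_of_nonneg_left (euclidDist_freeFlight_le hh w i) (by norm_num))
          hr.le
    _ = 8 * h / r * (((N + 1 : ℕ) : ℝ)⁻¹ * ∑ i, ‖(w i).2‖) := by
        rw [Finset.mul_sum, Finset.mul_sum, Finset.mul_sum]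
        refine Finset.sum_congr rfl fun i _ => ?_
        ring

/-- **`L¹(dx₀)` modulus of the mollified momentum under free flight**:
`∫ ‖m_r(S_h w) − m_r(w)‖ dx₀ ≤ (8h/r) (N+1)⁻¹ Σᵢ ‖vᵢ‖²`. [folklore] -/
theorem integral_norm_momC_freeFlight_sub_le {r : ℝ} (hr : 0 < r) (hr2 : r < 1 / 2) {h : ℝ} (hh : 0 ≤ h)
    (w : Phase N) :
    ∫ x, ‖momC r (freeFlight (Torus.geometry (Fin 3)) h w) x - momC r w x‖ ≤
      8 * h / r * (((N + 1 : ℕ) : ℝ)⁻¹ * ∑ i, ‖(w i).2‖ ^ 2) := by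
  set w' := freeFlight (Torus.geometry (Fin 3)) h w with hw'
  have hpt : ∀ x, ‖momC r w' x - momC r w x‖ ≤
      ((N + 1 : ℕ) : ℝ)⁻¹ * ∑ i, |cone r (w' i).1 x - cone r (w i).1 x| * ‖(w i).2‖ := by
    intro x
    rw [momC_eq_sum, momC_eq_sum, ← smul_sub, ← Finset.sum_sub_distrib, norm_smul, Real.norm_eq_abs,
      abs_of_nonneg (by positivity)]
    refine mul_le_mul_of_nonneg_left ((norm_sum_le _ _).trans (Finset.sum_le_sum fun i _ => ?_)) (by positivity)
    have hv : (w' i).2 = (w i).2 := rfl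
    rw [hv, ← sub_smul, norm_smul, Real.norm_eq_abs]
  have hci : ∀ i : Fin (N + 1), Integrable (fun x => |cone r (w' i).1 x - cone r (w i).1 x| * ‖(w i).2‖) volume :=
    fun i => (integrable_of_continuous_T3 ((continuous_cone r _).sub (continuous_cone r _))).abs.mul_const _
  calc ∫ x, ‖momC r w' x - momC r w x‖
      ≤ ∫ x, ((N + 1 : ℕ) : ℝ)⁻¹ * ∑ i, |cone r (w' i).1 x - cone r (w i).1 x| * ‖(w i).2‖ :=
        integral_mono_of_nonneg (ae_of_all _ fun x => norm_nonneg _) ((integrable_finsetSum _ fun i _ => hci i).const_mul _)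
          (ae_of_all _ hpt)
    _ = ((N + 1 : ℕ) : ℝ)⁻¹ * ∑ i, (∫ x, |cone r (w' i).1 x - cone r (w i).1 x|) * ‖(w i).2‖ := by
        rw [integral_const_mul, integral_finsetSum _ fun i _ => hci i]
        congr 1
        exact Finset.sum_congr rfl fun i _ => integral_mul_const _ _
    _ ≤ ((N + 1 : ℕ) : ℝ)⁻¹ * ∑ i, 8 * (h * ‖(w i).2‖) / r * ‖(w i).2‖ := by
        refine mul_le_mul_of_nonneg_left (Finset.sum_le_sum fun i _ => ?_) (by positivity)
        refine mul_le_mul_of_nonneg_right ((integral_abs_cone_sub_cone_le hr hr2 _ _).trans ?_) (norm_nonneg _)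
        exact div_le_div_of_nonneg_right (mul_le_mul_of_nonneg_left (euclidDist_freeFlight_le hh w i) (by norm_num))
          hr.le
    _ = 8 * h / r * (((N + 1 : ℕ) : ℝ)⁻¹ * ∑ i, ‖(w i).2‖ ^ 2) := by
        rw [Finset.mul_sum, Finset.mul_sum, Finset.mul_sum]
        refine Finset.sum_congr rfl fun i _ => ?_
        ring

/-! ## §4 `L¹(dx₀)` moduli under a binary momentum exchange -/

/-- Positions fix the mollified density: two configurations with the same positions have the same `ρ_r`.
[folklore] -/
theorem rhoC_eq_of_pos_eq {r : ℝ} {z z' : Phase N} (hpos : ∀ k, (z' k).1 = (z k).1) (x : T3) :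
    rhoC r z' x = rhoC r z x := by
  rw [rhoC_eq_sum, rhoC_eq_sum]
  simp only [hpos]

/-- **`L¹(dx₀)` jump of the mollified momentum at a binary momentum exchange.**  If `z'` differs from `z`
only in the velocities of `i ≠ j`, with `Δvⱼ = −Δvᵢ` (conservation of momentum in the pair), then
`∫ ‖m_r(z') − m_r(z)‖ dx₀ ≤ (N+1)⁻¹ (8 d(xᵢ, xⱼ)/r) ‖Δvᵢ‖`. [folklore] -/
theorem integral_norm_momC_exchange_sub_le {r : ℝ} (hr : 0 < r) (hr2 : r < 1 / 2) {z z' : Phase N}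
    {i j : Fin (N + 1)} (hij : i ≠ j) (hpos : ∀ k, (z' k).1 = (z k).1)
    (hvel : ∀ k, k ≠ i → k ≠ j → (z' k).2 = (z k).2)
    (hcons : (z' j).2 - (z j).2 = -((z' i).2 - (z i).2)) :
    ∫ x, ‖momC r z' x - momC r z x‖ ≤
      ((N + 1 : ℕ) : ℝ)⁻¹ * (8 * Torus.euclidDist (z i).1 (z j).1 / r) * ‖(z' i).2 - (z i).2‖ := by
  have hpt : ∀ x, momC r z' x - momC r z x =
      ((N + 1 : ℕ) : ℝ)⁻¹ • ((cone r (z i).1 x - cone r (z j).1 x) • ((z' i).2 - (z i).2)) := by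
    intro x
    rw [momC_eq_sum, momC_eq_sum, ← smul_sub, ← Finset.sum_sub_distrib]
    congr 1
    rw [Finset.sum_eq_add_of_mem i j (Finset.mem_univ i) (Finset.mem_univ j) hij]
    · rw [hpos i, hpos j, ← smul_sub, ← smul_sub, hcons, smul_neg, sub_smul]
      abel
    · intro k _ hk
      rw [hpos k, hvel k hk.1 hk.2, sub_self]
  have hnorm : ∀ x, ‖momC r z' x - momC r z x‖ =
      ((N + 1 : ℕ) : ℝ)⁻¹ * (|cone r (z i).1 x - cone r (z j).1 x| * ‖(z' i).2 - (z i).2‖) := by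
    intro x
    rw [hpt x, norm_smul, norm_smul, Real.norm_eq_abs, Real.norm_eq_abs, abs_of_nonneg (by positivity)]
  simp_rw [hnorm]
  rw [integral_const_mul, integral_mul_const, mul_assoc]
  refine mul_le_mul_of_nonneg_left ?_ (by positivity)
  exact mul_le_mul_of_nonneg_right (integral_abs_cone_sub_cone_le hr hr2 _ _) (norm_nonneg _)

/-! ## §5 Registered sub-goal -/

/-- **Registered sub-goal `stub_stressIsotropyOfWindowCovarianceB` (helper B of
`stub_stressIsotropyOfWindowCovariance`): the `L¹(dx₀)` displacement of the cone kernel**,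
`∫ |b_r(y, x) − b_r(y', x)| dx ≤ 8 d(y, y')/r` for `0 < r < 1/2` — the source of every transport / transfer
modulus of the window-to-cone step. [folklore] -/
theorem stub_stressIsotropyOfWindowCovarianceB : ∀ {r : ℝ}, 0 < r → r < 1 / 2 → ∀ (y y' : T3), ∫ x : T3, |3 / (Real.pi * r ^ 3) * max (1 - Torus.euclidDist y x / r) 0 - 3 / (Real.pi * r ^ 3) * max (1 - Torus.euclidDist y' x / r) 0| ≤ 8 * Torus.euclidDist y y' / r :=
  fun hr hr2 y y' => integral_abs_cone_sub_cone_le hr hr2 y y'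

end Summit.AtomisticToContinuum.HydrodynamicLimit.Theorems.ParityBandClosureWindowToCone

end
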